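import Literature.NumberTheory.GaloisCohomology.Howard2004.ConjugationDatumDeltaProofs
import Literature.NumberTheory.GaloisCohomology.Howard2004.DVRSettingEngineLocalInputsProofs
import HarnessLib

/-!
# `χ(δ_v) = 1` in the level rings at the engine primes, for every `DVRSetting` (the supplier `hχ` of the
# pairing letter `hδ`; proofs file)

Topic `NumberTheory/GaloisCohomology/Howard2004`.  THEOREMS ONLY: no definition, no named fact, no instance,
no notation, no `sorry`.

B. Howard, *The Heegner point Kolyvagin system*, Compositio Math. **140** (2004) = arXiv:1202.6340, H.4 (p. 7 L69–82)
and §1.6 (Thm. 1.6.1 over a `DVRSetting`).  The pairing letter `hδ` of `DVRSetting.engine_h159` (x9-p1-w4 g17: at every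
level `k` and every engine prime `v ∈ 𝓛^{(2k−1)}`, `e(u, ρ_k(δ_v) w) = e(w, ρ_k(δ_v) u)`) reduces by H.4 to
`ρ_k(τ⁻¹δ_vτ · δ_v) = 1` (trivial local action) and to **`χ(δ_v) = 1` in `R_k`** — this file supplies the latter for
EVERY `DVRSetting` and EVERY conjugation datum `S.cd`, from the datum-level `ConjugationDatumDeltaProofs`:

* `DVRSetting.exists_ringChar_levelRing_eq_pow` — `char R_k = p^c` with `1 ≤ c` (`R_k` is local and `p`-primary torsion);
* `DVRSetting.natCast_residueChar_succ_levelRing_eq_zero` — `ℓ + 1 = 0` in `R_k` for `v ∈ 𝓛^{(2k−1)}`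
  (`ℓ + 1 ∈ p^{2e_k−1} R ⊆ 𝔪^{e_k} = ker (R → R_k)`), hence `char R_k ∣ ℓ + 1`;
* **`DVRSetting.datum_hχ`** — `∀ k v, v ∈ S.enginePrimes k → algebraMap ℤ_[p] (Rk k) (χ(S.cd.δ v)) = 1`
  (`ConjugationDatum.algebraMap_cyclotomicCharacter_delta_eq_one` with `p^c = char R_k ∣ ℓ + 1`, `p ∤ ℓ − 1` as `p`
  is odd, `v = σv` a degree-two prime with `p ∉ v`).  No characteristic-zero assumption on `R` is used.

Cell `pub/bsd-print-x9`, G87 = Howard 2004 Thm. 1.6.1 (print leaf `stub_h161` of stmt-BirchSwinnertonDyer-22642);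
seat `bsd-line-x10b-p1-w5` g9, brick (DATUM-GEN) part 3 (hδ-CHI, S-level).  NOT HERE: the H.4 algebra `hχ ⇒ hδ`
(x9-p1-w4 g17, `DVRSettingDatumDeltaProofs.datum_hδ_of_hχ`); `thm161_dvrKolyvaginBound` is NOT proved; no summit statement
is proved; BSD is not proved by any of this.

References: [Howard2004HeegnerKolyvagin] H.4 (arXiv p. 7 L69–82), Def. 1.2.1 (p. 6 L57–68), §1.6 (p. 11);
[GrossLMS1991] §3 (3.3).
-/

set_option autoImplicit false

noncomputable section

open scoped NumberField
open NumberField IsDedekindDomain Field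

namespace Literature.NumberTheory.GaloisCohomology.Howard2004

open Literature.NumberTheory.GaloisRepresentations
open Literature.NumberTheory.EllipticCurves

namespace DVRSetting

variable {p : ℕ} [Fact p.Prime] {K : Type} [Field K] [NumberField K]
  {R : Type} [CommRing R] [IsDomain R] [IsDiscreteValuationRing R] [Algebra ℤ_[p] R]
  {N : ℕ → Type} [∀ k, AddCommGroup (N k)] [∀ k, TopologicalSpace (N k)]
  [∀ k, DiscreteTopology (N k)] [∀ k, Module R (N k)]
  {Rk : ℕ → Type} [∀ k, CommRing (Rk k)] [∀ k, IsLocalRing (Rk k)] [∀ k, TopologicalSpace (Rk k)]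
  [∀ k, DiscreteTopology (Rk k)] [∀ k, Algebra ℤ_[p] (Rk k)] [∀ k, Algebra R (Rk k)]
  [∀ k, Module (Rk k) (N k)] [∀ k, IsScalarTower R (Rk k) (N k)]
  {Nbar : Type} [AddCommGroup Nbar] [TopologicalSpace Nbar] [DiscreteTopology Nbar]
  [∀ k, Module (Rk k) Nbar]
  {Nq : ℕ → Finset (HeightOneSpectrum (𝓞 K)) → Type} [∀ k n, AddCommGroup (Nq k n)]
  [∀ k n, TopologicalSpace (Nq k n)] [∀ k n, DiscreteTopology (Nq k n)]
  [∀ k n, Module (Rk k) (Nq k n)] [∀ k n, Module R (Nq k n)]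
  [∀ k n, IsScalarTower R (Rk k) (Nq k n)]

/-- **`char R_k = p^c` with `1 ≤ c`**: the level ring `R_k` is `p`-primary torsion (`isPrimaryTorsion_levelRing`) and
non-trivial (local). [cite: Howard2004HeegnerKolyvagin, §1.6 (arXiv p. 11 L13–17: R_k = R/𝔪^{e_k})] -/
theorem exists_ringChar_levelRing_eq_pow (S : DVRSetting p K R N Rk Nbar Nq) (hy : S.SatisfiesH) (k : ℕ) :
    ∃ c : ℕ, 1 ≤ c ∧ ringChar (Rk k) = p ^ c := by
  have hp : p.Prime := Fact.out
  obtain ⟨m, hm⟩ := S.isPrimaryTorsion_levelRing hy k (1 : Rk k)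
  have hm' : ((p ^ m : ℕ) : Rk k) = 0 := by rw [← Nat.smul_one_eq_cast]; exact hm
  have hdvd : ringChar (Rk k) ∣ p ^ m := (ringChar.spec (Rk k) (p ^ m)).mp hm'
  obtain ⟨c, -, hc⟩ := (Nat.dvd_prime_pow hp).mp hdvd
  refine ⟨c, ?_, hc⟩
  by_contra hc0
  have hc0' : c = 0 := by omega
  rw [hc0', pow_zero] at hc
  have h1 : ((1 : ℕ) : Rk k) = 0 := (ringChar.spec (Rk k) 1).mpr (by rw [hc])
  rw [Nat.cast_one] at h1
  exact one_ne_zero h1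

/-- **`ℓ + 1 = 0` in `R_k` for an engine prime `v ∈ 𝓛^{(2k−1)}` over `ℓ`**: `ℓ + 1 ∈ p^{2e_k−1} R ⊆ 𝔪^{e_k} = ker (R → R_k)`.
[cite: Howard2004HeegnerKolyvagin, Def. 1.2.1 and §1.6 (arXiv p. 6 L63–68, p. 11 L33–38)] -/
theorem natCast_residueChar_succ_levelRing_eq_zero (S : DVRSetting p K R N Rk Nbar Nq) (hy : S.SatisfiesH)
    {k : ℕ} {v : HeightOneSpectrum (𝓞 K)} (hv : v ∈ S.enginePrimes k) :
    ((residueChar v + 1 : ℕ) : Rk k) = 0 := by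
  have hek : 1 ≤ S.e k := Nat.lt_of_lt_of_le hy.e_zero (hy.e_strictMono.monotone (Nat.zero_le k))
  obtain ⟨a, ha⟩ := Ideal.mem_span_singleton'.mp hv.2.2.1
  have hmem : ((residueChar v + 1 : ℕ) : R) ∈ IsLocalRing.maximalIdeal R ^ S.e k := by
    rw [← ha]
    refine Ideal.mul_mem_left _ _ (Ideal.pow_le_pow_right (show S.e k ≤ 2 * S.e k - 1 by omega) ?_)
    exact Ideal.pow_mem_pow (S.natCast_p_mem_maximalIdeal hy) _
  rw [← hy.ker_algebraMap k, RingHom.mem_ker, map_natCast] at hmem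
  exact hmem

/-- **The supplier `hχ` of the pairing letter `hδ`, for every `DVRSetting`**: at every level `k` and every engine prime
`v ∈ 𝓛^{(2k−1)}`, `χ(δ_v) = 1` in `R_k` (`χ` the `p`-adic cyclotomic character of `Γ_K`, `δ_v` the inner correction of
the conjugation datum `S.cd` at `v`).  From `ConjugationDatum.algebraMap_cyclotomicCharacter_delta_eq_one` with
`p^c := char R_k ∣ ℓ + 1`, `p ∤ ℓ − 1` (`p` odd), `v = σv` a degree-two prime over `ℓ` with `p ∉ v` (`𝓛 ⊆ 𝓛₀`).
[cite: Howard2004HeegnerKolyvagin, H.4 and §1.6 (arXiv p. 7 L69–82, p. 11 L33–38)] [cite: GrossLMS1991, §3 (3.3)] -/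
theorem datum_hχ (S : DVRSetting p K R N Rk Nbar Nq) (hy : S.SatisfiesH) :
    ∀ (k : ℕ) (v : HeightOneSpectrum (𝓞 K)), v ∈ S.enginePrimes k →
      algebraMap ℤ_[p] (Rk k) ((GaloisRep.cyclotomicCharacter K p (S.cd.δ v) : ℤ_[p]ˣ) : ℤ_[p]) = 1 := by
  intro k v hv
  have hp : p.Prime := Fact.out
  have hvL : v ∈ S.L := hv.1
  -- `v = σv`, degree two over `ℓ := residueChar v`, `p ∉ v`
  have hσv : S.cd.σ • v = v := S.sigma_smul_eq_self_of_mem_L hy hvL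
  have h0 : v ∈ Howard2004.degreeTwoPrimes p (S.T.ρ 0) := by
    have h' := hy.L_subset hvL
    rw [AdicTower.degreeTwoPrimes, Set.mem_iInter] at h'
    exact h' 0
  have hdeg : Nat.card (𝓞 K ⧸ v.asIdeal) = residueChar v ^ 2 := h0.1
  have hpv : (p : 𝓞 K) ∉ v.asIdeal := h0.2.1
  have hℓ : (residueChar v).Prime := prime_residueChar v
  have hℓv : (residueChar v : 𝓞 K) ∈ v.asIdeal := natCast_residueChar_mem_asIdeal v
  -- `char R_k = p^c ∣ ℓ + 1`
  obtain ⟨c, hc1, hc⟩ := S.exists_ringChar_levelRing_eq_pow hy k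
  have hdvd : p ^ c ∣ residueChar v + 1 := by
    rw [← hc]
    exact (ringChar.spec (Rk k) _).mp (S.natCast_residueChar_succ_levelRing_eq_zero hy hv)
  have hpl : ¬ p ∣ residueChar v - 1 := by
    intro hdm
    have hdp : p ∣ residueChar v + 1 := (dvd_pow_self p (by omega)).trans hdvd
    have h2 : p ∣ residueChar v + 1 - (residueChar v - 1) := Nat.dvd_sub hdp hdm
    have heq : residueChar v + 1 - (residueChar v - 1) = 2 := by
      have := hℓ.two_le
      omega
    rw [heq] at h2
    have hp2 : p ≤ 2 := Nat.le_of_dvd two_pos h2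
    exact hy.p_odd (le_antisymm hp2 hp.two_le)
  have hA : ((p ^ c : ℕ) : Rk k) = 0 := by
    rw [← hc]
    exact ringChar.Nat.cast_ringChar
  exact S.cd.algebraMap_cyclotomicCharacter_delta_eq_one hy.imagQuad hσv hℓ hℓv hdeg hpv hc1 hdvd hpl hA

end DVRSetting

end Literature.NumberTheory.GaloisCohomology.Howard2004

end
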